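import Summits.BirchSwinnertonDyer.BirchSwinnertonDyer.Theorems.EisensteinPrimesCharResidualSelmerKummer
import Summits.BirchSwinnertonDyer.BirchSwinnertonDyer.Theorems.EisensteinPrimesCharDualExactCount
import HarnessLib

/-!
# `R_nr^{S₀}(K_∞, 𝔽(θ̄)) ≅ H¹_{𝓕_nr^{S₀}}(K_∞, (F/𝒪)(θ))[p]` (Keller–Yin Lemma 1.2.4) and the COUNT
# `#R_nr^{S₀}(K_∞, 𝔽(θ̄)) = p^{λ(𝔛_θ^{S₀})} · #𝔛_θ^{S₀}[p]` (KY Lemma 1.4.3 with the finite part explicit)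
# (cell `bsd-eis`, seat `bsd-line-x1-p1-w4` gen 3, D-0154 WIDTH PASS; crux 2 `GoodLatticeBDPValue`
# stmt-BirchSwinnertonDyer-19032, line `halves` v19, road (B) to `stub_imprimLambda` = KY Thm. 1.4.1 (iii))

HONEST FRAMING (cell `bsd-eis`, run/shared/lean/pub/bsd-eis/): Galois-cohomology and Pontryagin bookkeeping
on constructed objects; no definition, no named fact, no `sorry`, no `Theses` import; nothing about any curve is
asserted; BSD / IMC2 / KY Thm. 1.4.1 are proved for NO curve. Helper `--supports stmt-BirchSwinnertonDyer-19032`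
(file 2 of 2; file 1 = `Theorems/EisensteinPrimesCharResidualSelmerKummer.lean`: both halves of Kummer for a
character and the reflection of each local condition along `j_*`).

## Why
After halves v19 the algebraic side of crux 2 rests on ONE preprint identity, KY Thm. 1.4.1 (iii)
`λ(𝔛^{Sf}_f) + [𝟙̃|_{G_K} = 𝟙] = λ(𝔛^{Sf}_ω̃) + λ(𝔛^{Sf}_𝟙̃)` (`stub_imprimLambda`). Its printed proof
(arXiv:2402.12781v2 §1.4, Lemmas 1.4.3–1.4.4, Cases I–III) is a residual-Selmer DIMENSION COUNT whose
entry point, for each of `? ∈ {ω̃, f, 𝟙̃}`, is the conversion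
`dim_𝔽 H¹_{𝓕_nr^S}(K, M_?[π]) = λ(𝔛^S_?) + dim_𝔽(H¹_{𝓕_nr^S}(K, M_?)/π)` = Lemma 1.2.4 (the residual group
IS the `π`-torsion of the big one) + the structure theorem ((Seltolambda), L1175–1185). The `E`-side of
this conversion is in the tree (`ResidualDevissageCountNonsplit.pow_lambdaInvariant_mul_natCard_pTorsion_eq`,
`UniversalToricDescentResidualSelmerExact`); the CHARACTER side was missing (x2-p2 g5, HOME STATUS l.3123).
This file supplies it, in the tree's `K_∞`-currency (`KellerYin2024.unrSelmer` / `grSelmer`, Pontryagin dual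
data `GreenbergVatsal2000.DatumDualData`):

* §4 SELMER LEVEL (KY Lemma 1.2.4 in the `K_∞`-formulation, both `𝓕_nr^{S₀}` and `𝓕_Gr^{S₀}`):
  `c ∈ unrSelmer κ A v̄ S₀ ↔ j_* c ∈ unrSelmer κ B v̄ S₀` (and `grSelmer`), `j_*` injective (LEAD, p634599),
  and onto the `p`-torsion (file 1); hence **`#unrSelmer κ A v̄ S₀ = #{s ∈ unrSelmer κ B v̄ S₀ | p s = 0}`**
  and the `Gr` twin.
* §5 THE ASSEMBLED COUNT: with the LEAD's exact Pontryagin–Herbrand count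
  `CharDualExactCount.pow_lambdaInvariant_mul_natCard_pTorsion_eq` (p639105: `p^{λ(D.X)} · #D.X[p] =
  #S^{S₀}_M(K_∞)[p]` for ANY dual datum `D` finitely generated torsion with `μ = 0`):
  **`#R_nr^{S₀}(K_∞, A) = p^{λ(𝔛_θ^{S₀})} · #𝔛_θ^{S₀}[p]`** for `A ≅ 𝔽(θ̄)` — KY Lemma 1.4.3 (i)/(iii) with
  KY's `dim(coker)+dim(K_?)` left as the honest finite part `#𝔛[p]` (no «no finite submodule» input);
  and the `∀`-dual-data form the line carries.

NOT here (next bricks of road (B)): the index `[R_nr(A) : R_Gr(A)]` at `v̄` (local; `= 1` for the `ω̃`-type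
character); KY Lemma 1.4.4 (generalised snake lemma along `0 → 𝔽(ω̃) → E[p] → 𝔽(𝟙̃) → 0`); the `H²`
comparison `K_f ↔ K_ω̃`; the vanishing of `#𝔛_𝟙̃^{S}[p]` (Greenberg 1989 + GV Prop. 2.5).

References: [KellerYin2024] Lemma 1.2.4, Prop. 1.2.5, Lemma 1.4.3 (arXiv:2402.12781v2 TeX L760–800,
L1175–1190); [CastellaGrossiLeeSkinner2022] Lemma 13, Prop. 14 (arXiv:2008.02571 §1.2);
[GreenbergVatsal2000] §2 Prop. (2.8) and p. 27; [Washington1997] §13.2; [SerreGaloisCohomology1997] I.§2.2–2.4.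
-/

set_option autoImplicit false
set_option linter.dupNamespace false -- the summit namespace `…BirchSwinnertonDyer.BirchSwinnertonDyer.Theorems` (Sub = Summit, D-0017) trips it

noncomputable section

open scoped Classical AddSubgroup

namespace Summit.BirchSwinnertonDyer.BirchSwinnertonDyer.Theorems.CharResidualSelmerCount

open NumberField IsDedekindDomain Field
open Literature.NumberTheory.EllipticCurves Literature.NumberTheory.EllipticCurves.GreenbergSelmer
  Literature.NumberTheory.EllipticCurves.GreenbergVatsal2000 Literature.NumberTheory.GaloisRepresentations
  Literature.NumberTheory.EllipticCurves.KellerYin2024 Literature.NumberTheory.IwasawaTheory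
  Literature.NumberTheory.EllipticCurves.FineSelmerCoefficientMap
  Summit.BirchSwinnertonDyer.BirchSwinnertonDyer.Theorems.CharResidualSelmerFinite
  Summit.BirchSwinnertonDyer.BirchSwinnertonDyer.Theorems.UniversalToricDescentResidualSelmer
/-! ### §4 Selmer level: KY Lemma 1.2.4 for `𝓕_nr^{S₀}` and `𝓕_Gr^{S₀}` over `K_∞` -/

section Selmer

variable {K : Type} [Field K] [NumberField K] {p : ℕ} [hp : Fact p.Prime]
  (θ : FramedGaloisRep K (padicCoeffIntegers (∅ : Set (PadicAlgCl p))) 1)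
  (κ : ZpExtension K p) (vbar : HeightOneSpectrum (𝓞 K)) (S₀ : Set (HeightOneSpectrum (𝓞 K)))

variable {A : Type} [AddCommGroup A] [DistribMulAction (absoluteGaloisGroup K) A] [TopologicalSpace A]
  [DiscreteTopology A]

/-- **`c ∈ H¹_{𝓕_nr^{S₀}}(K_∞, A) ↔ j_* c ∈ H¹_{𝓕_nr^{S₀}}(K_∞, (F/𝒪)(θ))`** for `A ↪ (F/𝒪)(θ)` equivariant
onto the `p`-torsion, `θ^{p−1} = 1`: every defining condition ("a conjugate is unramified at `w ∉ S₀`,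
`w ∤ p`", "a conjugate satisfies Greenberg's condition for Castella's datum above `p`" — unramified above
`v̄`, vacuous above the other primes over `p`) reflects along `j_*` (§3), and `j_*` commutes with the
conjugations (`conjH1_comp_resH1Hom_id`). [cite: KellerYin2024, Lemma 1.2.4 (arXiv:2402.12781v2 TeX L760–778)]
[cite: GreenbergVatsal2000, §2 pp. 16–17, 20] -/
theorem mem_unrSelmer_iff_resH1Hom_id_mem
    (hθ : ∀ σ : absoluteGaloisGroup K, θ σ ^ (p - 1) = 1)
    (j : A →+ charModule (∅ : Set (PadicAlgCl p)) θ)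
    (hj : ∀ (σ : absoluteGaloisGroup K) (a : A), j (σ • a) = σ • j a) (hinj : Function.Injective j)
    (hrange : ∀ x : charModule (∅ : Set (PadicAlgCl p)) θ, x ∈ j.range ↔ p • x = 0)
    (c : subgroupH1 κ.kerSubgroup A) :
    c ∈ unrSelmer κ A vbar S₀ ↔
      resH1Hom (ContinuousMonoidHom.id κ.kerSubgroup) j (fun g a ↦ hj (g : absoluteGaloisGroup K) a) c ∈
        unrSelmer κ (charModule (∅ : Set (PadicAlgCl p)) θ) vbar S₀ := by
  have hconj : ∀ σ : absoluteGaloisGroup K,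
      conjH1 κ.kerSubgroup (charModule (∅ : Set (PadicAlgCl p)) θ) σ
          (resH1Hom (ContinuousMonoidHom.id κ.kerSubgroup) j
            (fun g a ↦ hj (g : absoluteGaloisGroup K) a) c) =
        resH1Hom (ContinuousMonoidHom.id κ.kerSubgroup) j (fun g a ↦ hj (g : absoluteGaloisGroup K) a)
          (conjH1 κ.kerSubgroup A σ c) :=
    fun σ ↦ congrArg (fun f ↦ f c) (conjH1_comp_resH1Hom_id κ.kerSubgroup j
      (fun g a ↦ hj (g : absoluteGaloisGroup K) a) hj σ)
  change c ∈ datumSelmer κ.kerSubgroup A p (Castella2018.AcSelmer.bdpData A p vbar) S₀ ↔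
    _ ∈ datumSelmer κ.kerSubgroup (charModule (∅ : Set (PadicAlgCl p)) θ) p
      (Castella2018.AcSelmer.bdpData (charModule (∅ : Set (PadicAlgCl p)) θ) p vbar) S₀
  rw [mem_datumSelmer_iff, mem_datumSelmer_iff, mem_unramifiedOutside_iff, mem_unramifiedOutside_iff]
  refine and_congr ⟨fun h v hv hpv σ ↦ ?_, fun h v hv hpv σ ↦ ?_⟩
    ⟨fun h v hv σ ↦ ?_, fun h v hv σ ↦ ?_⟩
  · rw [hconj]
    exact (mem_unramifiedKer_iff_resH1Hom_id_mem θ κ.kerSubgroup hθ v j hj hinj hrange _).mp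
      (h v hv hpv σ)
  · have h' := h v hv hpv σ
    rw [hconj] at h'
    exact (mem_unramifiedKer_iff_resH1Hom_id_mem θ κ.kerSubgroup hθ v j hj hinj hrange _).mpr h'
  · rw [hconj]
    by_cases hv𝔭 : v = vbar
    · subst hv𝔭
      have h' := h v hv σ
      rw [Castella2018.AcSelmer.bdpData_self p v hv, mem_greenbergKer_strictDatum_iff] at h' ⊢
      exact (mem_unramifiedKer_iff_resH1Hom_id_mem θ κ.kerSubgroup hθ v j hj hinj hrange _).mp h'
    · rw [Castella2018.AcSelmer.bdpData_of_ne p vbar hv hv𝔭, greenbergKer_relaxedDatum_eq_top]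
      exact AddSubgroup.mem_top _
  · have h' := h v hv σ
    rw [hconj] at h'
    by_cases hv𝔭 : v = vbar
    · subst hv𝔭
      rw [Castella2018.AcSelmer.bdpData_self p v hv, mem_greenbergKer_strictDatum_iff] at h' ⊢
      exact (mem_unramifiedKer_iff_resH1Hom_id_mem θ κ.kerSubgroup hθ v j hj hinj hrange _).mpr h'
    · rw [Castella2018.AcSelmer.bdpData_of_ne p vbar hv hv𝔭, greenbergKer_relaxedDatum_eq_top]
      exact AddSubgroup.mem_top _

/-- **`c ∈ H¹_{𝓕_Gr^{S₀}}(K_∞, A) ↔ j_* c ∈ H¹_{𝓕_Gr^{S₀}}(K_∞, (F/𝒪)(θ))`** (the STRICT twin: locally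
trivial above `v̄`). [cite: KellerYin2024, Lemma 1.2.4 and display (Gr,θ) (arXiv:2402.12781v2 TeX L736–778)]
[cite: GreenbergVatsal2000, §2 pp. 15, 20] -/
theorem mem_grSelmer_iff_resH1Hom_id_mem
    (hθ : ∀ σ : absoluteGaloisGroup K, θ σ ^ (p - 1) = 1)
    (j : A →+ charModule (∅ : Set (PadicAlgCl p)) θ)
    (hj : ∀ (σ : absoluteGaloisGroup K) (a : A), j (σ • a) = σ • j a) (hinj : Function.Injective j)
    (hrange : ∀ x : charModule (∅ : Set (PadicAlgCl p)) θ, x ∈ j.range ↔ p • x = 0)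
    (c : subgroupH1 κ.kerSubgroup A) :
    c ∈ grSelmer κ A vbar S₀ ↔
      resH1Hom (ContinuousMonoidHom.id κ.kerSubgroup) j (fun g a ↦ hj (g : absoluteGaloisGroup K) a) c ∈
        grSelmer κ (charModule (∅ : Set (PadicAlgCl p)) θ) vbar S₀ := by
  have hconj : ∀ σ : absoluteGaloisGroup K,
      conjH1 κ.kerSubgroup (charModule (∅ : Set (PadicAlgCl p)) θ) σ
          (resH1Hom (ContinuousMonoidHom.id κ.kerSubgroup) j
            (fun g a ↦ hj (g : absoluteGaloisGroup K) a) c) =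
        resH1Hom (ContinuousMonoidHom.id κ.kerSubgroup) j (fun g a ↦ hj (g : absoluteGaloisGroup K) a)
          (conjH1 κ.kerSubgroup A σ c) :=
    fun σ ↦ congrArg (fun f ↦ f c) (conjH1_comp_resH1Hom_id κ.kerSubgroup j
      (fun g a ↦ hj (g : absoluteGaloisGroup K) a) hj σ)
  change c ∈ datumStrictSelmer κ.kerSubgroup A p (Castella2018.AcSelmer.bdpData A p vbar) S₀ ↔
    _ ∈ datumStrictSelmer κ.kerSubgroup (charModule (∅ : Set (PadicAlgCl p)) θ) p
      (Castella2018.AcSelmer.bdpData (charModule (∅ : Set (PadicAlgCl p)) θ) p vbar) S₀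
  rw [mem_datumStrictSelmer_iff, mem_datumStrictSelmer_iff, mem_unramifiedOutside_iff,
    mem_unramifiedOutside_iff]
  refine and_congr ⟨fun h v hv hpv σ ↦ ?_, fun h v hv hpv σ ↦ ?_⟩
    ⟨fun h v hv σ ↦ ?_, fun h v hv σ ↦ ?_⟩
  · rw [hconj]
    exact (mem_unramifiedKer_iff_resH1Hom_id_mem θ κ.kerSubgroup hθ v j hj hinj hrange _).mp
      (h v hv hpv σ)
  · have h' := h v hv hpv σ
    rw [hconj] at h'
    exact (mem_unramifiedKer_iff_resH1Hom_id_mem θ κ.kerSubgroup hθ v j hj hinj hrange _).mpr h'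
  · rw [hconj]
    by_cases hv𝔭 : v = vbar
    · subst hv𝔭
      have h' := h v hv σ
      rw [Castella2018.AcSelmer.bdpData_self p v hv] at h' ⊢
      exact (mem_strictKer_strictDatum_iff_resH1Hom_id_mem θ κ.kerSubgroup hθ v j hj hinj hrange _).mp h'
    · rw [Castella2018.AcSelmer.bdpData_of_ne p vbar hv hv𝔭, Castella2018.AcSelmer.strictKer_relaxedDatum_eq_top]
      exact AddSubgroup.mem_top _
  · have h' := h v hv σ
    rw [hconj] at h'
    by_cases hv𝔭 : v = vbar
    · subst hv𝔭
      rw [Castella2018.AcSelmer.bdpData_self p v hv] at h' ⊢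
      exact (mem_strictKer_strictDatum_iff_resH1Hom_id_mem θ κ.kerSubgroup hθ v j hj hinj hrange _).mpr h'
    · rw [Castella2018.AcSelmer.bdpData_of_ne p vbar hv hv𝔭, Castella2018.AcSelmer.strictKer_relaxedDatum_eq_top]
      exact AddSubgroup.mem_top _

omit [NumberField K] in
/-- **Every `p`-torsion class of `H¹(H, (F/𝒪)(θ))`, `H ≤ Γ_K`, is `j_*` of a class of `H¹(H, A)`**
(§1 with the divisibility and orbit continuity of §2). [cite: KellerYin2024, Lemma 1.2.4 (arXiv:2402.12781v2 TeX L760–778)]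
[cite: SerreGaloisCohomology1997, I.§2.2 (Prop. 2)] -/
theorem exists_resH1Hom_id_eq_charModule (H : Subgroup (absoluteGaloisGroup K))
    (j : A →+ charModule (∅ : Set (PadicAlgCl p)) θ)
    (hj : ∀ (σ : absoluteGaloisGroup K) (a : A), j (σ • a) = σ • j a) (hinj : Function.Injective j)
    (hrange : ∀ x : charModule (∅ : Set (PadicAlgCl p)) θ, x ∈ j.range ↔ p • x = 0)
    (y : subgroupH1 H (charModule (∅ : Set (PadicAlgCl p)) θ)) (hy : p • y = 0) :
    ∃ x : subgroupH1 H A,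
      resH1Hom (ContinuousMonoidHom.id H) j (fun g a ↦ hj (g : absoluteGaloisGroup K) a) x = y :=
  exists_resH1Hom_id_eq_of_nsmul_eq_zero (G := H) j _ hinj hrange
    (fun b ↦ (continuous_smul_charModule θ b).comp continuous_subtype_val) (charModule_divisible θ) y hy

/-- **KY Lemma 1.2.4, `𝓕_nr^{S₀}`, as a COUNT: `#H¹_{𝓕_nr^{S₀}}(K_∞, A) = #H¹_{𝓕_nr^{S₀}}(K_∞, (F/𝒪)(θ))[p]`**
(`A ↪ (F/𝒪)(θ)` equivariant onto the `p`-torsion, `θ^{p−1} = 1`; any `ℤ_p`-extension `κ`, any `v̄`,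
`S₀`): `j_*` restricts to a BIJECTION from the residual group onto the `p`-torsion of the big one —
injective (LEAD, `resH1Hom_id_injective_charModule`), condition-reflecting (`mem_unrSelmer_iff_resH1Hom_id_mem`),
onto (`exists_resH1Hom_id_eq_charModule`; classes of `H¹(K_∞, A)` are `p`-torsion since `pA = 0`). As
`Nat.card` (both sides `0` if infinite). [cite: KellerYin2024, Lemma 1.2.4 (arXiv:2402.12781v2 TeX L760–778)]
[cite: CastellaGrossiLeeSkinner2022, Lemma 13, Prop. 14 (arXiv:2008.02571 §1.2)] -/
theorem natCard_unrSelmer_eq_natCard_pTorsion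
    (hθ : ∀ σ : absoluteGaloisGroup K, θ σ ^ (p - 1) = 1)
    (j : A →+ charModule (∅ : Set (PadicAlgCl p)) θ)
    (hj : ∀ (σ : absoluteGaloisGroup K) (a : A), j (σ • a) = σ • j a) (hinj : Function.Injective j)
    (hrange : ∀ x : charModule (∅ : Set (PadicAlgCl p)) θ, x ∈ j.range ↔ p • x = 0) :
    Nat.card (unrSelmer κ A vbar S₀) =
      Nat.card {s : unrSelmer κ (charModule (∅ : Set (PadicAlgCl p)) θ) vbar S₀ // p • s = 0} := by
  let jH := resH1Hom (ContinuousMonoidHom.id κ.kerSubgroup) j (fun g a ↦ hj (g : absoluteGaloisGroup K) a)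
  have hpA : ∀ a : A, p • a = 0 := fun a ↦ hinj (by
    rw [map_nsmul, map_zero]; exact (hrange (j a)).mp ⟨a, rfl⟩)
  have hpc : ∀ c : subgroupH1 κ.kerSubgroup A, p • c = 0 := nsmul_discreteH1_eq_zero (G := κ.kerSubgroup) hpA
  let F : unrSelmer κ A vbar S₀ →
      {s : unrSelmer κ (charModule (∅ : Set (PadicAlgCl p)) θ) vbar S₀ // p • s = 0} :=
    fun c ↦ ⟨⟨jH c, (mem_unrSelmer_iff_resH1Hom_id_mem θ κ vbar S₀ hθ j hj hinj hrange _).mp c.2⟩,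
      Subtype.ext (by
        change p • jH c = 0
        rw [← map_nsmul, hpc, map_zero])⟩
  refine Nat.card_eq_of_bijective F ⟨fun c c' h ↦ ?_, fun s ↦ ?_⟩
  · have h' : jH c = jH c' := congrArg (fun s ↦ ((s.1 : unrSelmer κ _ vbar S₀) :
      subgroupH1 κ.kerSubgroup (charModule (∅ : Set (PadicAlgCl p)) θ))) h
    exact Subtype.ext (resH1Hom_id_injective_charModule θ hθ κ.kerSubgroup j hj hinj hrange h')
  · have hs : p • ((s.1 : unrSelmer κ _ vbar S₀) :
        subgroupH1 κ.kerSubgroup (charModule (∅ : Set (PadicAlgCl p)) θ)) = 0 := by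
      rw [← AddSubgroupClass.coe_nsmul, s.2]; rfl
    obtain ⟨c, hc⟩ := exists_resH1Hom_id_eq_charModule θ κ.kerSubgroup j hj hinj hrange _ hs
    have hcmem : c ∈ unrSelmer κ A vbar S₀ := by
      rw [mem_unrSelmer_iff_resH1Hom_id_mem θ κ vbar S₀ hθ j hj hinj hrange, hc]
      exact s.1.2
    exact ⟨⟨c, hcmem⟩, Subtype.ext (Subtype.ext hc)⟩

/-- **KY Lemma 1.2.4, `𝓕_Gr^{S₀}` (strict) twin: `#H¹_{𝓕_Gr^{S₀}}(K_∞, A) = #H¹_{𝓕_Gr^{S₀}}(K_∞, (F/𝒪)(θ))[p]`.**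
The left side is Castella's residual strict group `R_v̄^{S₀}(K_∞, A)` of the tree's dévissage files.
[cite: KellerYin2024, Lemma 1.2.4 and display (Gr,θ) (arXiv:2402.12781v2 TeX L736–778)]
[cite: CastellaGrossiLeeSkinner2022, Lemma 13, Prop. 14 (arXiv:2008.02571 §1.2)] -/
theorem natCard_grSelmer_eq_natCard_pTorsion
    (hθ : ∀ σ : absoluteGaloisGroup K, θ σ ^ (p - 1) = 1)
    (j : A →+ charModule (∅ : Set (PadicAlgCl p)) θ)
    (hj : ∀ (σ : absoluteGaloisGroup K) (a : A), j (σ • a) = σ • j a) (hinj : Function.Injective j)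
    (hrange : ∀ x : charModule (∅ : Set (PadicAlgCl p)) θ, x ∈ j.range ↔ p • x = 0) :
    Nat.card (grSelmer κ A vbar S₀) =
      Nat.card {s : grSelmer κ (charModule (∅ : Set (PadicAlgCl p)) θ) vbar S₀ // p • s = 0} := by
  let jH := resH1Hom (ContinuousMonoidHom.id κ.kerSubgroup) j (fun g a ↦ hj (g : absoluteGaloisGroup K) a)
  have hpA : ∀ a : A, p • a = 0 := fun a ↦ hinj (by
    rw [map_nsmul, map_zero]; exact (hrange (j a)).mp ⟨a, rfl⟩)
  have hpc : ∀ c : subgroupH1 κ.kerSubgroup A, p • c = 0 := nsmul_discreteH1_eq_zero (G := κ.kerSubgroup) hpA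
  let F : grSelmer κ A vbar S₀ →
      {s : grSelmer κ (charModule (∅ : Set (PadicAlgCl p)) θ) vbar S₀ // p • s = 0} :=
    fun c ↦ ⟨⟨jH c, (mem_grSelmer_iff_resH1Hom_id_mem θ κ vbar S₀ hθ j hj hinj hrange _).mp c.2⟩,
      Subtype.ext (by
        change p • jH c = 0
        rw [← map_nsmul, hpc, map_zero])⟩
  refine Nat.card_eq_of_bijective F ⟨fun c c' h ↦ ?_, fun s ↦ ?_⟩
  · have h' : jH c = jH c' := congrArg (fun s ↦ ((s.1 : grSelmer κ _ vbar S₀) :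
      subgroupH1 κ.kerSubgroup (charModule (∅ : Set (PadicAlgCl p)) θ))) h
    exact Subtype.ext (resH1Hom_id_injective_charModule θ hθ κ.kerSubgroup j hj hinj hrange h')
  · have hs : p • ((s.1 : grSelmer κ _ vbar S₀) :
        subgroupH1 κ.kerSubgroup (charModule (∅ : Set (PadicAlgCl p)) θ)) = 0 := by
      rw [← AddSubgroupClass.coe_nsmul, s.2]; rfl
    obtain ⟨c, hc⟩ := exists_resH1Hom_id_eq_charModule θ κ.kerSubgroup j hj hinj hrange _ hs
    have hcmem : c ∈ grSelmer κ A vbar S₀ := by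
      rw [mem_grSelmer_iff_resH1Hom_id_mem θ κ vbar S₀ hθ j hj hinj hrange, hc]
      exact s.1.2
    exact ⟨⟨c, hcmem⟩, Subtype.ext (Subtype.ext hc)⟩

end Selmer

/-! ### §5 The assembled character-side residual count -/

section Count

variable {K : Type} [Field K] [NumberField K] {p : ℕ} [hp : Fact p.Prime] (κ : ZpExtension K p)
  {γ : absoluteGaloisGroup K} (S₀ : Set (HeightOneSpectrum (𝓞 K))) (vbar : HeightOneSpectrum (𝓞 K))
  (θ : FramedGaloisRep K (padicCoeffIntegers (∅ : Set (PadicAlgCl p))) 1)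
  {A : Type} [AddCommGroup A] [DistribMulAction (absoluteGaloisGroup K) A] [TopologicalSpace A]
  [DiscreteTopology A]

/-- **THE CHARACTER-SIDE RESIDUAL COUNT (KY Lemma 1.2.4 + (Seltolambda) = Lemma 1.4.3 (i)/(iii) with the
finite part explicit): `#R_nr^{S₀}(K_∞, A) = p^{λ(𝔛_θ^{S₀})} · #𝔛_θ^{S₀}[p]`** for `A ↪ (F/𝒪)(θ)`
equivariant onto the `p`-torsion (`A ≅ 𝔽(θ̄)`, `θ^{p−1} = 1`) and ANY dual datum `𝔛_θ^{S₀} = D.X` of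
`H¹_{𝓕_nr^{S₀}}(K_∞, (F/𝒪)(θ))` finitely generated torsion with `μ = 0` (the line's kernel clause,
`Thm141TorsionClauses` / `prop125_residualPair_unrSelmer_imprimitive`). KY: "`d(Sel(M_𝟙̃[π])) = λ(𝔛^S_𝟙̃)`",
"`d(Sel(M_ω̃[π])) = λ(𝔛^S_ω̃) + d(coker_ω̃[π]) + d(K_ω̃)`" — here `#𝔛[p]` names the finite part for both.
[cite: KellerYin2024, Lemma 1.2.4, Lemma 1.4.3 (arXiv:2402.12781v2 TeX L760–778, L1186–1190)]
[cite: GreenbergVatsal2000, §2 Prop. (2.8)] [cite: Washington1997, §13.2] -/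
theorem natCard_unrSelmer_residual_eq_pow_lambdaInvariant_mul
    (hθ : ∀ σ : absoluteGaloisGroup K, θ σ ^ (p - 1) = 1)
    (j : A →+ charModule (∅ : Set (PadicAlgCl p)) θ)
    (hj : ∀ (σ : absoluteGaloisGroup K) (a : A), j (σ • a) = σ • j a) (hinj : Function.Injective j)
    (hrange : ∀ x : charModule (∅ : Set (PadicAlgCl p)) θ, x ∈ j.range ↔ p • x = 0)
    (D : DatumDualData κ γ (charModule (∅ : Set (PadicAlgCl p)) θ)
      (Castella2018.AcSelmer.bdpData (charModule (∅ : Set (PadicAlgCl p)) θ) p vbar) S₀)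
    [Module.Finite (IwasawaAlgebra p) D.X] (hT : Module.IsTorsion (IwasawaAlgebra p) D.X)
    (hμ : muInvariant p D.X = 0) :
    Nat.card (unrSelmer κ A vbar S₀) = p ^ lambdaInvariant p D.X * Nat.card {x : D.X // p • x = 0} := by
  rw [natCard_unrSelmer_eq_natCard_pTorsion θ κ vbar S₀ hθ j hj hinj hrange]
  exact (CharDualExactCount.pow_lambdaInvariant_mul_natCard_pTorsion_eq D hT hμ).symm

/-- **The same from the `∀`-form the line carries** ("EVERY dual datum of `H¹_{𝓕_nr^{S₀}}(K_∞, (F/𝒪)(θ))` is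
finitely generated torsion with `μ = 0`" — the first clause of `prop125_residualPair_unrSelmer_imprimitive`,
kernel modulo PUB on the `halves` line; dual data exist for a topological generator, `nonempty_unrDualData_char`):
for every dual datum `D`, `#R_nr^{S₀}(K_∞, A) = p^{λ(D.X)} · #D.X[p]`.
[cite: KellerYin2024, Prop. 1.2.5 and Lemma 1.4.3 (arXiv:2402.12781v2 TeX L780–800, L1186–1190)] -/
theorem natCard_unrSelmer_residual_eq_of_forall_dualData
    (hθ : ∀ σ : absoluteGaloisGroup K, θ σ ^ (p - 1) = 1)
    (j : A →+ charModule (∅ : Set (PadicAlgCl p)) θ)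
    (hj : ∀ (σ : absoluteGaloisGroup K) (a : A), j (σ • a) = σ • j a) (hinj : Function.Injective j)
    (hrange : ∀ x : charModule (∅ : Set (PadicAlgCl p)) θ, x ∈ j.range ↔ p • x = 0)
    (hS : ∀ D : DatumDualData κ γ (charModule (∅ : Set (PadicAlgCl p)) θ)
      (Castella2018.AcSelmer.bdpData (charModule (∅ : Set (PadicAlgCl p)) θ) p vbar) S₀,
      Module.Finite (IwasawaAlgebra p) D.X ∧ Module.IsTorsion (IwasawaAlgebra p) D.X ∧
        muInvariant p D.X = 0)
    (D : DatumDualData κ γ (charModule (∅ : Set (PadicAlgCl p)) θ)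
      (Castella2018.AcSelmer.bdpData (charModule (∅ : Set (PadicAlgCl p)) θ) p vbar) S₀) :
    Nat.card (unrSelmer κ A vbar S₀) = p ^ lambdaInvariant p D.X * Nat.card {x : D.X // p • x = 0} := by
  obtain ⟨hfg, hT, hμ⟩ := hS D
  haveI := hfg
  exact natCard_unrSelmer_residual_eq_pow_lambdaInvariant_mul κ S₀ vbar θ hθ j hj hinj hrange D hT hμ

end Count

end Summit.BirchSwinnertonDyer.BirchSwinnertonDyer.Theorems.CharResidualSelmerCount

end
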